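import Summits.PneNP.PneNP.Theorems.ConvexRankGatesConvexGateBlindStubPerfectCompletenessFourier

/-!
# The Tseitin contradiction on the honeycomb torus: the instance and its boundaries
(helper for stub `stub_perfectCompleteness` of line `xor-door-perfect-completeness`, crux `ConvexGateBlind`,
item stmt-PneNP-10680; registered sub-goal `stub_perfectCompleteness_honeycomb`)

The brick-wall (honeycomb) torus on `Fin n × Fin n` (`n` even): every horizontal edge
`(i, j) — (i, j+1)` is present, the vertical slot `(i, j) — (i+1, j)` is an edge iff `i + j` is even, so
the graph is cubic. Variables are the `n² + n²` edge slots (`enc`; unused odd vertical slots are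
harmless dummy variables), the equation of the vertex `v = (i, j)` is
`y (hE v) + y (hL v) + y (vert v) = hcC v` on its three edges (`hcA v = {hE v, hL v, vert v}`), with
charge `1` at the origin only (`hcC`). This file: the instance, parities on the even cycle, which
equations contain a given variable, and membership in the parity boundary `bd (hcA n) T` of
`…StubPerfectCompletenessFourier` (`hE_mem_bd`, `vE_mem_bd`, `vE_not_mem_bd`). Isoperimetry,
connectedness and unsatisfiability are in the sequel `…StubPerfectCompletenessHoneycombIso`.
(Tseitin 1968; the torus instance is the standard width example, e.g. Grigoriev 2001, §3.)
-/

set_option linter.dupNamespace false -- `Summit.PneNP.PneNP.…`: summit = sub-problem (D-0017)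

namespace Summit.PneNP.PneNP.Theorems.XorDoor.PC

open Finset

noncomputable section

variable {m : ℕ}
/-! ### The honeycomb (brick-wall) torus -/

section Honeycomb

variable (n : ℕ)

/-- Encoding of the edge slots: horizontal slots `inl (i, j)` and vertical slots `inr (i, j)` as
variables `Fin (n² + n²)`. [folklore] -/
def enc : (Fin n × Fin n) ⊕ (Fin n × Fin n) ≃ Fin (n * n + n * n) :=
  (Equiv.sumCongr finProdFinEquiv finProdFinEquiv).trans finSumFinEquiv

/-- The horizontal edge `(i, j) — (i, j+1)` (right edge of the vertex `(i, j)`). [folklore] -/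
def hE (v : Fin n × Fin n) : Fin (n * n + n * n) := enc n (Sum.inl v)

/-- The vertical slot `(i, j) — (i+1, j)` (an edge of the brick wall iff `i + j` is even). [folklore] -/
def vE (v : Fin n × Fin n) : Fin (n * n + n * n) := enc n (Sum.inr v)

/-- The parity of a coordinate. [folklore] -/
def par (i : Fin n) : ZMod 2 := (i.val : ZMod 2)

/-- The column of an edge slot. [folklore] -/
def colOf (x : Fin (n * n + n * n)) : Fin n := Sum.elim Prod.snd Prod.snd ((enc n).symm x)

/-- The row of an edge slot. [folklore] -/
def rowOf (x : Fin (n * n + n * n)) : Fin n := Sum.elim Prod.fst Prod.fst ((enc n).symm x)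

variable {n}

/-! ### Injectivity and decoding -/

/-- `hE` is injective. [folklore] -/
theorem hE_inj {v w : Fin n × Fin n} : hE n v = hE n w ↔ v = w := by
  unfold hE
  rw [(enc n).injective.eq_iff, Sum.inl_injective.eq_iff]

/-- `vE` is injective. [folklore] -/
theorem vE_inj {v w : Fin n × Fin n} : vE n v = vE n w ↔ v = w := by
  unfold vE
  rw [(enc n).injective.eq_iff, Sum.inr_injective.eq_iff]

/-- Horizontal and vertical slots differ. [folklore] -/
theorem hE_ne_vE (v w : Fin n × Fin n) : hE n v ≠ vE n w := by
  unfold hE vE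
  rw [Ne, (enc n).injective.eq_iff]
  exact Sum.inl_ne_inr

/-- Columns of horizontal slots. [folklore] -/
@[simp] theorem colOf_hE (v : Fin n × Fin n) : colOf n (hE n v) = v.2 := by
  simp [colOf, hE]

/-- Columns of vertical slots. [folklore] -/
@[simp] theorem colOf_vE (v : Fin n × Fin n) : colOf n (vE n v) = v.2 := by
  simp [colOf, vE]

/-- Rows of horizontal slots. [folklore] -/
@[simp] theorem rowOf_hE (v : Fin n × Fin n) : rowOf n (hE n v) = v.1 := by
  simp [rowOf, hE]

variable (n) [NeZero n]

/-- The left horizontal edge `(i, j-1) — (i, j)` of the vertex `(i, j)`. [folklore] -/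
def hL (v : Fin n × Fin n) : Fin (n * n + n * n) := hE n (v.1, v.2 - 1)

/-- The vertical edge of the vertex `(i, j)`: down `(i, j) — (i+1, j)` if `i + j` is even, up
`(i-1, j) — (i, j)` if `i + j` is odd (the brick wall is cubic). [folklore] -/
def vert (v : Fin n × Fin n) : Fin (n * n + n * n) :=
  if par n v.1 + par n v.2 = 0 then vE n v else vE n (v.1 - 1, v.2)

/-- The three variables of the Tseitin equation at the vertex `v`. [folklore] -/
def hcA (v : Fin n × Fin n) : Finset (Fin (n * n + n * n)) := {hE n v, hL n v, vert n v}

/-- The charges: `1` at the origin, `0` elsewhere (odd total charge). [folklore] -/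
def hcC (v : Fin n × Fin n) : ZMod 2 := if v = (0, 0) then 1 else 0

variable {n}

/-! ### Parities on the even torus -/

/-- `vert v` is a vertical slot. [folklore] -/
theorem vert_eq (v : Fin n × Fin n) :
    vert n v = vE n (if par n v.1 + par n v.2 = 0 then v else (v.1 - 1, v.2)) := by
  unfold vert
  split_ifs <;> rfl


/-- `1 + 1 = 0` in `𝔽₂`. [folklore] -/
theorem one_add_one_eq_zero : (1 + 1 : ZMod 2) = 0 := by decide

/-- `2 ≤ n` for an even positive `n`. [folklore] -/
theorem two_le (hn : Even n) : 2 ≤ n := by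
  obtain ⟨k, hk⟩ := hn
  have := NeZero.ne n
  omega

/-- On an even cycle the parity alternates: `par (i + 1) = par i + 1`. [folklore] -/
theorem par_add_one (hn : Even n) (i : Fin n) : par n (i + 1) = par n i + 1 := by
  have h2 := two_le hn
  unfold par
  rw [Fin.val_add, Fin.val_one', Nat.mod_eq_of_lt (by omega : 1 < n)]
  have hdvd : 2 ∣ n := even_iff_two_dvd.1 hn
  have hmod : (((i.val + 1) % n : ℕ) : ZMod 2) = ((i.val + 1 : ℕ) : ZMod 2) := by
    rw [ZMod.natCast_eq_natCast_iff', Nat.mod_mod_of_dvd _ hdvd]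
  rw [hmod]
  push_cast
  ring

/-- `par (i - 1) = par i + 1`. [folklore] -/
theorem par_sub_one (hn : Even n) (i : Fin n) : par n (i - 1) = par n i + 1 := by
  have h := par_add_one hn (i - 1)
  rw [sub_add_cancel] at h
  rw [h, add_assoc, one_add_one_eq_zero, add_zero]

/-- `j ≠ j + 1` on a cycle of length `≥ 2`. [folklore] -/
theorem ne_add_one (hn : Even n) (j : Fin n) : j ≠ j + 1 := by
  intro h
  have h2 := two_le hn
  have hv := congrArg Fin.val h
  rw [Fin.val_add, Fin.val_one', Nat.mod_eq_of_lt (by omega : 1 < n)] at hv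
  have hj := j.isLt
  by_cases hlt : j.val + 1 < n
  · rw [Nat.mod_eq_of_lt hlt] at hv
    omega
  · have heq : j.val + 1 = n := by omega
    rw [heq, Nat.mod_self] at hv
    omega

/-! ### Which equations contain a given variable -/

/-- The horizontal edge `hE (i, j)` lies in the equations of `(i, j)` and `(i, j+1)` only. [folklore] -/
theorem hE_mem_hcA_iff (i j : Fin n) (v : Fin n × Fin n) :
    hE n (i, j) ∈ hcA n v ↔ v = (i, j) ∨ v = (i, j + 1) := by
  unfold hcA hL
  rw [mem_insert, mem_insert, mem_singleton, hE_inj, hE_inj, vert_eq]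
  constructor
  · rintro (h | h | h)
    · exact Or.inl h.symm
    · refine Or.inr ?_
      obtain ⟨a, b⟩ := v
      simp only [Prod.mk.injEq] at h ⊢
      exact ⟨h.1.symm, by rw [h.2, sub_add_cancel]⟩
    · exact absurd h (hE_ne_vE _ _)
  · rintro (rfl | rfl)
    · exact Or.inl rfl
    · exact Or.inr (Or.inl (by simp))

/-- A used vertical slot `vE (i, j)` (`i + j` even) lies in the equations of `(i, j)` and
`(i+1, j)` only. [folklore] -/
theorem vE_mem_hcA_iff (hn : Even n) {i j : Fin n} (hij : par n i + par n j = 0)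
    (v : Fin n × Fin n) : vE n (i, j) ∈ hcA n v ↔ v = (i, j) ∨ v = (i + 1, j) := by
  unfold hcA hL
  rw [mem_insert, mem_insert, mem_singleton, vert_eq, vE_inj]
  have hodd : par n (i + 1) + par n j ≠ 0 := by
    rw [par_add_one hn, add_right_comm, hij, zero_add]
    exact one_ne_zero
  obtain ⟨a, b⟩ := v
  constructor
  · rintro (h | h | h)
    · exact absurd h.symm (hE_ne_vE _ _)
    · exact absurd h.symm (hE_ne_vE _ _)
    · split_ifs at h with hab
      · exact Or.inl h.symm
      · refine Or.inr ?_
        simp only [Prod.mk.injEq] at h ⊢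
        exact ⟨by rw [h.1, sub_add_cancel], h.2.symm⟩
  · rintro (h | h)
    · rw [h]
      exact Or.inr (Or.inr (by rw [if_pos hij]))
    · rw [h]
      refine Or.inr (Or.inr ?_)
      rw [if_neg hodd]
      simp

/-- An unused vertical slot `vE (i, j)` (`i + j` odd) lies in no equation. [folklore] -/
theorem vE_not_mem_hcA (hn : Even n) {i j : Fin n} (hij : par n i + par n j ≠ 0)
    (v : Fin n × Fin n) : vE n (i, j) ∉ hcA n v := by
  unfold hcA hL
  rw [mem_insert, mem_insert, mem_singleton, vert_eq, vE_inj]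
  obtain ⟨a, b⟩ := v
  rintro (h | h | h)
  · exact hE_ne_vE _ _ h.symm
  · exact hE_ne_vE _ _ h.symm
  · split_ifs at h with hab
    · simp only [Prod.mk.injEq] at h
      rw [h.1, h.2] at hij
      exact hij hab
    · simp only [Prod.mk.injEq] at h
      apply hab
      have ha : a = i + 1 := by rw [h.1, sub_add_cancel]
      rw [ha, ← h.2, par_add_one hn, add_right_comm]
      rcases eq_zero_or_eq_one (par n i + par n j) with h0 | h0
      · exact absurd h0 hij
      · rw [h0, one_add_one_eq_zero]

/-! ### Boundary membership -/

/-- Parity count of a variable lying in exactly the equations `a ≠ b`. [folklore] -/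
theorem bsum_eq_of_iff {W : Type*} [DecidableEq W] {B : W → Finset (Fin m)} {x : Fin m} {a b : W}
    (hab : a ≠ b) (hx : ∀ v, x ∈ B v ↔ v = a ∨ v = b) (T : Finset W) :
    bsum B T x = (if a ∈ T then 1 else 0) + (if b ∈ T then 1 else 0) := by
  unfold bsum
  rw [← Finset.sum_ite_eq' T a (fun _ => (1 : ZMod 2)), ← Finset.sum_ite_eq' T b (fun _ => 1),
    ← sum_add_distrib]
  refine sum_congr rfl fun v _ => ?_
  by_cases ha : v = a
  · subst ha
    simp [hx, hab]
  · by_cases hb : v = b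
    · subst hb
      simp [hx, ha]
    · simp [hx, ha, hb]

/-- Boundary membership of a variable lying in exactly the equations `a ≠ b`: exactly one of
`a`, `b` is in `T`. [folklore] -/
theorem mem_bd_of_iff {W : Type*} [DecidableEq W] {B : W → Finset (Fin m)} {x : Fin m} {a b : W}
    (hab : a ≠ b) (hx : ∀ v, x ∈ B v ↔ v = a ∨ v = b) (T : Finset W) :
    x ∈ bd B T ↔ (a ∈ T ↔ b ∉ T) := by
  rw [mem_bd, bsum_eq_of_iff hab hx]
  by_cases ha : a ∈ T <;> by_cases hb : b ∈ T <;> simp [ha, hb, one_add_one_eq_zero]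

/-- `hE (i, j) ∈ ∂T` iff exactly one of `(i, j)`, `(i, j+1)` lies in `T`. [folklore] -/
theorem hE_mem_bd (hn : Even n) (T : Finset (Fin n × Fin n)) (i j : Fin n) :
    hE n (i, j) ∈ bd (hcA n) T ↔ ((i, j) ∈ T ↔ (i, j + 1) ∉ T) :=
  mem_bd_of_iff (by simp [ne_add_one hn j]) (hE_mem_hcA_iff i j) T

/-- A used `vE (i, j) ∈ ∂T` iff exactly one of `(i, j)`, `(i+1, j)` lies in `T`. [folklore] -/
theorem vE_mem_bd (hn : Even n) (T : Finset (Fin n × Fin n)) {i j : Fin n}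
    (hij : par n i + par n j = 0) :
    vE n (i, j) ∈ bd (hcA n) T ↔ ((i, j) ∈ T ↔ (i + 1, j) ∉ T) :=
  mem_bd_of_iff (by simp [ne_add_one hn i]) (vE_mem_hcA_iff hn hij) T

/-- An unused vertical slot is never a boundary variable. [folklore] -/
theorem vE_not_mem_bd (hn : Even n) (T : Finset (Fin n × Fin n)) {i j : Fin n}
    (hij : par n i + par n j ≠ 0) : vE n (i, j) ∉ bd (hcA n) T := by
  rw [mem_bd]
  unfold bsum
  rw [sum_congr rfl fun v _ => if_neg (vE_not_mem_hcA hn hij v), sum_const_zero]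
  exact fun h => one_ne_zero h.symm

end Honeycomb

/-- Registered sub-goal `stub_perfectCompleteness_honeycomb` of stub `stub_perfectCompleteness`:
horizontal boundary edges of the honeycomb torus. [folklore] -/
theorem stub_perfectCompleteness_honeycomb : ∀ {n : ℕ} [NeZero n], Even n →
    ∀ (T : Finset (Fin n × Fin n)) (i j : Fin n),
    hE n (i, j) ∈ bd (hcA n) T ↔ ((i, j) ∈ T ↔ (i, j + 1) ∉ T) :=
  fun hn T i j => hE_mem_bd hn T i j

end

end Summit.PneNP.PneNP.Theorems.XorDoor.PC
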